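import Mathlib
import HarnessLib
import Summits.NavierStokesRegularity.NavierStokesRegularity.Theorems.UnthreadedDoorAntidynamoWallSteadyCore
import Summits.NavierStokesRegularity.NavierStokesRegularity.Theorems.ThreadingFluxCentreJetSteadyStratumMild

/-!
# Route `UnthreadedDoor` / `ThreadingFlux`, crux `PoloidalLiouville` (stmt-NavierStokesRegularity-1222), antidynamo v2 skeleton
# (sha16 `4ebf5683127b`), WALL `stub_scalarLiouville`: THE STEADY-VORTICITY SECTOR OF THE WALL IS THE STEADY STRATUM H₂ᵐ BY NAME —
# hence follows from the classical steady statement H₂, and from the rigidity conjecture C1* alone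

Support file (seat leafhand-ns-unthreadeddoor-2 g1, cell decomp-ns), `--supports stmt-NavierStokesRegularity-1222 --as helper`; theorems only.

The steady STRATUM of the crux in the tree (`Precession.SteadyPoloidalLiouvilleW1`, H₂ᵐ, restated verbatim as a hypothesis as in
`ThreadingFluxCentreJetSteadyStratumMild`) is about flows CONSTANT IN TIME.  A priori the wall's steady SECTOR is larger: flows whose VORTICITY
is steady — they include every Galilean-drifting `V + b(t)`.  By p816327 (`curl_eq_zero_or_steady_of_curl_steady`: steady vorticity ⇒ irrotational
∨ exactly steady velocity) the two coincide:

* ★★ `steadyVorticitySector_of_steadyStratum` — H₂ᵐ ⇒ the wall (slice-wise constancy) for every flow of the class with STEADY VORTICITY.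
* ★★ `steadyVorticitySector_of_steadyPoloidalLiouville` — hence from the CLASSICAL steady statement H₂ (`C²/C¹` bounded steady flow, unthreaded
  ⇒ constant; via `CentreJet.steadyPoloidalLiouvilleW1_of_steadyPoloidalLiouville`, p-chain of ns-wall-eng-7).
* ★★ `steadyVorticitySector_of_steadyLocalRigidity` — hence from the rigidity conjecture C1* `CentreJet.SteadyLocalRigidity` ALONE
  (`CentreJet.steadyPoloidalLiouvilleW1_of_steadyLocalRigidity`).
* `periodicVorticitySector_of_periodicStratum` — likewise the `τ`-periodic-vorticity sector is the exactly-`τ`-periodic stratum by name.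

HONEST LABEL: by-name reductions (pure logic over p816327 and the landed steady-stratum bridges); H₂, H₂ᵐ, C1*, `stub_scalarLiouville`,
`PoloidalLiouville` (1222) and NS regularity remain OPEN; no summit statement is proved (crux 1222 is INCOMPARABLE with the summit). [folklore]
[cite: KochNadirashviliSereginSverak2009, Thm 5.2 (arXiv:0709.3599 pp. 9–10)]
-/

noncomputable section

-- the summit and its single sub-problem share the name (CONVENTIONS §1)
set_option linter.dupNamespace false

open scoped Topology InnerProductSpace RealInnerProductSpace ContDiff
open Filter Set Function Metric MeasureTheory
open Literature.Analysis.FluidPDE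

namespace Summit.NavierStokesRegularity.NavierStokesRegularity.Theorems.PoloidalLiouville.Antidynamo

open Summit.NavierStokesRegularity.NavierStokesRegularity.Theorems.PoloidalLiouville
  (constantOfIrrotational)
open Summit.NavierStokesRegularity.NavierStokesRegularity.Theorems.PoloidalLiouville.NetFlux (E3)

/-! ### ★★ Steady-vorticity sector = steady stratum, by name -/

/-- ★★ **THE STEADY-VORTICITY SECTOR OF THE WALL FROM THE STEADY STRATUM H₂ᵐ.**  If every bounded ancient mild solution of the class that is
CONSTANT IN TIME and unthreaded about `x₀` is slice-wise constant (H₂ᵐ, `Precession.SteadyPoloidalLiouvilleW1` verbatim), then so is every flow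
of the class, unthreaded about `x₀`, whose VORTICITY is steady (`curl v(t − τ) = curl v(t)` for all `τ > 0`, `t < 0`).
[cite: KochNadirashviliSereginSverak2009, Thm 5.2 (arXiv:0709.3599 pp. 9–10)] -/
theorem steadyVorticitySector_of_steadyStratum
    (hW1 : ∀ (v : ℝ → E3 → E3) (x₀ : E3),
      IsBoundedAncientMildSolution 1 v → (∀ t < 0, AEStronglyMeasurable (v t) volume) →
      ContDiffOn ℝ (⊤ : ℕ∞) (uncurry v) (Iio 0 ×ˢ univ) → (∀ s < 0, ∀ t < 0, v s = v t) →
      (∀ t < 0, ∀ x, inner ℝ (x - x₀) (curl (v t) x) = 0) →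
      ∀ t < 0, ∃ b : E3, ∀ x, v t x = b) :
    ∀ (v : ℝ → E3 → E3) (x₀ : E3),
      IsBoundedAncientMildSolution 1 v → (∀ t < 0, AEStronglyMeasurable (v t) volume) →
      ContDiffOn ℝ (⊤ : ℕ∞) (uncurry v) (Iio 0 ×ˢ univ) →
      (∀ t < 0, ∀ x, inner ℝ (x - x₀) (curl (v t) x) = 0) →
      (∀ τ : ℝ, 0 < τ → ∀ t < 0, ∀ x, curl (v (t - τ)) x = curl (v t) x) →
      ∀ t < 0, ∃ b : E3, ∀ x, v t x = b := by
  intro v x₀ hB hm hsm hun hst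
  rcases curl_eq_zero_or_steady_of_curl_steady v x₀ hB hm hsm hun hst with h | h
  · exact constantOfIrrotational v hB hsm h
  · exact hW1 v x₀ hB hm hsm (fun s hs t ht => funext (h s hs t ht)) hun

/-- ★★ **… FROM THE CLASSICAL STEADY STATEMENT H₂** (`C²` velocity, `C¹` pressure, steady momentum equation pointwise, bounded, unthreaded ⇒
constant), through `CentreJet.steadyPoloidalLiouvilleW1_of_steadyPoloidalLiouville`. [cite: MajdaBertozziCUP2002, §2.4.4 Prop. 2.21 (steady case)] -/
theorem steadyVorticitySector_of_steadyPoloidalLiouville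
    (h : ∀ (V : E3 → E3) (p : E3 → ℝ) (x₀ : E3), ContDiff ℝ 2 V → ContDiff ℝ 1 p → VectorCalculus.IsDivFree V →
      (∀ x, fderiv ℝ V x (V x) + gradient p x = Laplacian.laplacian V x) →
      (∃ B : ℝ, ∀ x, ‖V x‖ ≤ B) → CentreJet.IsUnthreadedAbout x₀ V → ∃ b : E3, ∀ x, V x = b) :
    ∀ (v : ℝ → E3 → E3) (x₀ : E3),
      IsBoundedAncientMildSolution 1 v → (∀ t < 0, AEStronglyMeasurable (v t) volume) →
      ContDiffOn ℝ (⊤ : ℕ∞) (uncurry v) (Iio 0 ×ˢ univ) →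
      (∀ t < 0, ∀ x, inner ℝ (x - x₀) (curl (v t) x) = 0) →
      (∀ τ : ℝ, 0 < τ → ∀ t < 0, ∀ x, curl (v (t - τ)) x = curl (v t) x) →
      ∀ t < 0, ∃ b : E3, ∀ x, v t x = b :=
  steadyVorticitySector_of_steadyStratum (CentreJet.steadyPoloidalLiouvilleW1_of_steadyPoloidalLiouville h)

/-- ★★ **… FROM THE RIGIDITY CONJECTURE C1* ALONE** (the master local rigidity of the «steady-centre-sieve» card, hypothesis VERBATIM as in
`CentreJet.steadyPoloidalLiouvilleW1_of_steadyLocalRigidity`): the whole steady-vorticity sector of the wall is conditional on C1* only. [folklore] -/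
theorem steadyVorticitySector_of_steadyLocalRigidity
    (hC1 : ∀ (V : E3 → E3) (p : E3 → ℝ) (x₀ : E3) (ρ : ℝ), 0 < ρ →
      AnalyticOnNhd ℝ V (Metric.ball x₀ ρ) → AnalyticOnNhd ℝ p (Metric.ball x₀ ρ) →
      CentreJet.IsSteadyNSOn (Metric.ball x₀ ρ) V p → (∀ x ∈ Metric.ball x₀ ρ, inner ℝ (x - x₀) (curl V x) = 0) →
      (∃ x ∈ Metric.ball x₀ ρ, curl V x ≠ 0) →
      ∃ g : E3 ≃ₗᵢ[ℝ] E3,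
        (∀ θ : ℝ, ∀ y : E3, ‖y‖ < ρ → g.symm (V (x₀ + g (rotZ θ y))) = rotZ θ (g.symm (V (x₀ + g y)))) ∧
        ∀ y : E3, ‖y‖ < ρ → swirl (fun z => g.symm (V (x₀ + g z))) y = 0) :
    ∀ (v : ℝ → E3 → E3) (x₀ : E3),
      IsBoundedAncientMildSolution 1 v → (∀ t < 0, AEStronglyMeasurable (v t) volume) →
      ContDiffOn ℝ (⊤ : ℕ∞) (uncurry v) (Iio 0 ×ˢ univ) →
      (∀ t < 0, ∀ x, inner ℝ (x - x₀) (curl (v t) x) = 0) →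
      (∀ τ : ℝ, 0 < τ → ∀ t < 0, ∀ x, curl (v (t - τ)) x = curl (v t) x) →
      ∀ t < 0, ∃ b : E3, ∀ x, v t x = b :=
  steadyVorticitySector_of_steadyStratum (CentreJet.steadyPoloidalLiouvilleW1_of_steadyLocalRigidity hC1)

/-! ### The periodic-vorticity sector = the exactly periodic stratum, by name -/

/-- **THE `τ`-PERIODIC-VORTICITY SECTOR FROM THE EXACTLY `τ`-PERIODIC STRATUM.**  If every flow of the class that is EXACTLY `τ`-periodic in time
and unthreaded about `x₀` is slice-wise constant, then so is every flow of the class, unthreaded about `x₀`, whose VORTICITY is `τ`-periodic.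
[cite: KochNadirashviliSereginSverak2009, Thm 5.2 (arXiv:0709.3599 pp. 9–10)] -/
theorem periodicVorticitySector_of_periodicStratum {τ : ℝ} (hτ : 0 < τ)
    (hP : ∀ (v : ℝ → E3 → E3) (x₀ : E3),
      IsBoundedAncientMildSolution 1 v → (∀ t < 0, AEStronglyMeasurable (v t) volume) →
      ContDiffOn ℝ (⊤ : ℕ∞) (uncurry v) (Iio 0 ×ˢ univ) → (∀ t < 0, v (t - τ) = v t) →
      (∀ t < 0, ∀ x, inner ℝ (x - x₀) (curl (v t) x) = 0) →
      ∀ t < 0, ∃ b : E3, ∀ x, v t x = b) :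
    ∀ (v : ℝ → E3 → E3) (x₀ : E3),
      IsBoundedAncientMildSolution 1 v → (∀ t < 0, AEStronglyMeasurable (v t) volume) →
      ContDiffOn ℝ (⊤ : ℕ∞) (uncurry v) (Iio 0 ×ˢ univ) →
      (∀ t < 0, ∀ x, inner ℝ (x - x₀) (curl (v t) x) = 0) →
      (∀ t < 0, ∀ x, curl (v (t - τ)) x = curl (v t) x) →
      ∀ t < 0, ∃ b : E3, ∀ x, v t x = b := by
  intro v x₀ hB hm hsm hun hper
  rcases curl_eq_zero_or_periodic_of_curl_periodic v x₀ hB hm hsm hun hτ hper with h | h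
  · exact constantOfIrrotational v hB hsm h
  · exact hP v x₀ hB hm hsm (fun t ht => funext (h t ht)) hun

end Summit.NavierStokesRegularity.NavierStokesRegularity.Theorems.PoloidalLiouville.Antidynamo

end
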